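import Summits.BirchSwinnertonDyer.BirchSwinnertonDyer.Theorems.SignedLowerHalvesSmallImageLowerHalfBothSignsRttD2SeqSemilocExactCarrier
import Summits.BirchSwinnertonDyer.BirchSwinnertonDyer.Theorems.SignedLowerHalvesSmallImageLowerHalfBothSignsRttD2SeqJ3HPerf
import Mathlib.Data.ZMod.Units
import HarnessLib

/-!
# Route `SignedLowerHalves`, crux L `SmallImageLowerHalfBothSigns` (stmt-BirchSwinnertonDyer-23599), line `rtt_w3` v32 — stub S3β″ (`stub_junctionPT_ns`), input N5-(iii)
# (unramified generator), component C7 (compatibility): A COMPATIBLE SYSTEM OF GENERATORS `ζ_k ∈ μ_{p^k}(K̄)`, `ζ_{k+1}^p = ζ_k`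

WIDTH seat `bsd-line-slh-p3-w3` g27 under LEAD `cruxlead-stmt-BirchSwinnertonDyer-23599` g14 (cell `bsd-ssimc`); helper `--supports stmt-BirchSwinnertonDyer-23599`
(plan `Lines/rtt_w3-DESIGN-N5iii-w3-g26.md` §2 C7). THEOREMS ONLY (no definition, no named fact, no instance, no `sorry`). HONEST FRAMING: elementary — a generator of the Tate module
`ℤ_p(1) = lim← μ_{p^k}(K̄)`: generators `ζ_k` of the cyclic groups `μ_{p^k}(K̄)` (g24 `exists_generator_muCarrier`) chosen COMPATIBLY under the `p`-power maps (generators descend, g26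
`generator_muPowMap`; units of `ℤ/p^k` lift to `ℤ/p^{k+1}`, Mathlib `ZMod.unitsMap_surjective`). Used to make the unramified level generators `u_{w,n,k} ↦ δ_1 ⊗ (1 ⊗ ζ_k)` compatible under
reduction. Nothing about S3β″, crux L or BSD is proved; all remain OPEN and are proved for NO curve.
References: [SerreLocalFields1979] IV §4; [NeukirchSchmidtWingberg2008] (7.2.6), (7.3.x) (`ℤ_p(1)`).
-/

set_option autoImplicit false
set_option linter.dupNamespace false -- D-0017: single-problem summit, the namespace repeats the problem name by design
noncomputable section

open scoped Classical
open NumberField Field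

namespace Summit.BirchSwinnertonDyer.BirchSwinnertonDyer.Theorems.SmallImageRttD2Seq

open Literature.NumberTheory.GaloisRepresentations Literature.NumberTheory.GaloisRepresentations.DiscreteGaloisModule

variable (K : Type) [Field K] [NumberField K] {p : ℕ} [Fact p.Prime]

omit [NumberField K] in
/-- **A `ζ₀ ∈ μ_{p^m}` sent to `1` by an isomorphism `μ_{p^m} ≃ ℤ/p^m` generates, with exact order `p^m`.** [cite: SerreLocalFields1979, IV §4] -/
theorem generator_of_equiv_apply_eq_one (m : ℕ) (e : MuCarrier K (p ^ m) ≃+ ZMod (p ^ m)) {ζ₀ : MuCarrier K (p ^ m)} (he : e ζ₀ = 1) :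
    (∀ ζ : MuCarrier K (p ^ m), ∃ j : ℤ, ζ = j • ζ₀) ∧ ∀ j : ℤ, j • ζ₀ = 0 ↔ ((p ^ m : ℕ) : ℤ) ∣ j := by
  haveI : NeZero (p ^ m) := ⟨pow_ne_zero _ (Fact.out : p.Prime).ne_zero⟩
  refine ⟨fun ζ ↦ ⟨((e ζ).val : ℤ), e.injective ?_⟩, fun j ↦ ?_⟩
  · rw [map_zsmul, he, zsmul_eq_mul, mul_one, Int.cast_natCast, ZMod.natCast_zmod_val]
  · rw [← e.map_eq_zero_iff, map_zsmul, he, zsmul_eq_mul, mul_one, ZMod.intCast_zmod_eq_zero_iff_dvd]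

/-- **Generators lift compatibly**: a generator `ζ` of `μ_{p^k}` (`e ζ = 1`) is the `p`-th power of a generator of `μ_{p^{k+1}}`. [cite: SerreLocalFields1979, IV §4] [cite: NeukirchSchmidtWingberg2008, (7.3.x)] -/
theorem exists_generator_lift (k : ℕ) (e : MuCarrier K (p ^ k) ≃+ ZMod (p ^ k)) {ζ : MuCarrier K (p ^ k)} (he : e ζ = 1) :
    ∃ η : MuCarrier K (p ^ (k + 1)), (∃ e' : MuCarrier K (p ^ (k + 1)) ≃+ ZMod (p ^ (k + 1)), e' η = 1) ∧ muPowMap K (pow_dvd_pow p (Nat.le_succ k)) η = ζ := by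
  haveI : NeZero (p ^ k) := ⟨pow_ne_zero _ (Fact.out : p.Prime).ne_zero⟩
  haveI : NeZero (p ^ (k + 1)) := ⟨pow_ne_zero _ (Fact.out : p.Prime).ne_zero⟩
  obtain ⟨e₁, η₀, he₁, hgen₁, hord₁⟩ := exists_generator_muCarrier K (p := p) (k + 1)
  have hgen₁' : ∀ ζ' : MuCarrier K (p ^ (k + 1)), ∃ j : ℤ, ζ' = j • η₀ := fun ζ' ↦ ⟨_, hgen₁ ζ'⟩
  -- `η₀^p` generates `μ_{p^k}`, so `c = e(η₀^p)` is a unit of `ℤ/p^k`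
  obtain ⟨hgen₀, -⟩ := generator_muPowMap (K := K) (pow_dvd_pow p (Nat.le_succ k)) (NeZero.ne _) (NeZero.ne _) hgen₁' hord₁
  obtain ⟨j, hj⟩ := hgen₀ ζ
  set c : ZMod (p ^ k) := e (muPowMap K (pow_dvd_pow p (Nat.le_succ k)) η₀) with hc
  have hcu : IsUnit c := by
    refine IsUnit.of_mul_eq_one (j : ZMod (p ^ k)) ?_
    rw [mul_comm, ← zsmul_eq_mul, hc, ← map_zsmul, ← hj, he]
  obtain ⟨u, hu⟩ := ZMod.unitsMap_surjective (hm := inferInstance) (pow_dvd_pow p (Nat.le_succ k)) hcu.unit⁻¹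
  refine ⟨(u : ZMod (p ^ (k + 1))).val • η₀, ⟨e₁.trans (AddAut.mulRight u⁻¹), ?_⟩, ?_⟩
  · rw [AddEquiv.trans_apply, AddAut.mulRight_apply, map_nsmul, he₁, nsmul_eq_mul, mul_one, ZMod.natCast_zmod_val, Units.mul_inv]
  · apply e.injective
    rw [map_nsmul, map_nsmul, he, nsmul_eq_mul, ZMod.natCast_val, ← ZMod.unitsMap_val (pow_dvd_pow p (Nat.le_succ k)), hu]
    exact hcu.unit.inv_mul

/-- ★ **A COMPATIBLE SYSTEM OF GENERATORS `(ζ_k)_k`, `ζ_k ∈ μ_{p^k}(K̄)`, `ζ_{k+1}^p = ζ_k`** (a generator of the Tate module `ℤ_p(1)`), each `ζ_k` sent to `1` by some `μ_{p^k} ≃ ℤ/p^k`.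
[cite: NeukirchSchmidtWingberg2008, (7.3.x)] [cite: SerreLocalFields1979, IV §4] -/
theorem exists_compatible_generators :
    ∃ ζ : (k : ℕ) → MuCarrier K (p ^ k), (∀ k, ∃ e : MuCarrier K (p ^ k) ≃+ ZMod (p ^ k), e (ζ k) = 1) ∧
      ∀ k, muPowMap K (pow_dvd_pow p (Nat.le_succ k)) (ζ (k + 1)) = ζ k := by
  have step : ∀ (k : ℕ) (ζ : MuCarrier K (p ^ k)), (∃ e : MuCarrier K (p ^ k) ≃+ ZMod (p ^ k), e ζ = 1) →
      ∃ η : MuCarrier K (p ^ (k + 1)), (∃ e' : MuCarrier K (p ^ (k + 1)) ≃+ ZMod (p ^ (k + 1)), e' η = 1) ∧ muPowMap K (pow_dvd_pow p (Nat.le_succ k)) η = ζ :=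
    fun k ζ ⟨e, he⟩ ↦ exists_generator_lift K k e he
  choose! next hnext using step
  obtain ⟨e₀, ζ₀, he₀, -, -⟩ := exists_generator_muCarrier K (p := p) 0
  let ζ : (k : ℕ) → MuCarrier K (p ^ k) := fun k ↦ Nat.rec (motive := fun k ↦ MuCarrier K (p ^ k)) ζ₀ (fun k ζk ↦ next k ζk) k
  have hgen : ∀ k, ∃ e : MuCarrier K (p ^ k) ≃+ ZMod (p ^ k), e (ζ k) = 1 := by
    intro k
    induction k with
    | zero => exact ⟨e₀, he₀⟩
    | succ k ih => exact (hnext k (ζ k) ih).1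
  exact ⟨ζ, hgen, fun k ↦ (hnext k (ζ k) (hgen k)).2⟩

end Summit.BirchSwinnertonDyer.BirchSwinnertonDyer.Theorems.SmallImageRttD2Seq

end
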